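import Mathlib.MeasureTheory.Measure.Haar.NormedSpace
import Mathlib.MeasureTheory.Measure.Lebesgue.EqHaar
import Mathlib.Analysis.InnerProductSpace.PiL2
import Literature.Analysis.FunctionSpaces.FlatTorus
import Literature.Analysis.FluidPDE.HardSpherePhaseSpace
import HarnessLib

/-!
# Recollision geometry: thin cones and tubes, lattice translates, and BGSR Lemma 5.2
(Bodineau–Gallagher–Saint-Raymond, Invent. Math. 203 (2016) = arXiv:1305.3397v2, Lemma 5.2 and
Appendix B "Recollisions in the torus"; after Gallagher–Saint-Raymond–Texier 2013, Lemma 12.2.1;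
trunk T-KINETIC, topic MathematicalPhysics/KineticTheory; a leaf of §5 (geometric control of
recollisions) in the bottom-up proof of the named facts `bgsr_linearBoltzmannApprox` /
`bgsr_theorem22`, see `TaggedSphereLinearBoltzmannRate` and `TaggedSphereLinearBoltzmann`.)

BGSR Lemma 5.2 (p. 17 of the held text, chunk p0017): *"Given `t > 0`, and `ā > 0` satisfying
`A^{K+1} ε ≪ ā ≪ ε₀ ≪ min(δE, 1)`, consider two points `x₁⁰, x₂⁰` in `T^d` such that
`d(x₁⁰, x₂⁰) ≥ ε₀`, and a velocity `v₁ ∈ B_E`. Then there exists a subset `K(x₁⁰ - x₂⁰, ε₀, ā)`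
of `ℝ^d` with measure bounded by `|K| ≤ C E^d ((ā/ε₀)^{d-1} + (Et)^d ā^{d-1})` … such that for any
`v₂ ∈ B_E` and `x₁, x₂` such that `|x₁ - x₁⁰| ≤ ā`, `|x₂ - x₂⁰| ≤ ā`, the following results hold:
If `v₁ - v₂ ∉ K(x₁⁰ - x₂⁰, ε₀, ā)`, then `∀ u ∈ [0, t], d(x₁ - u v₁, x₂ - u v₂) > ε`"* (first
bullet; the second bullet gives a set `K_δ` with
`|K_δ| ≤ C E ((ε₀/δ)^{d-1} + (Et)^d E^{d-1} ε₀^{d-1})` outside of which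
`∀ u ∈ [δ, t], d(x₁ - u v₁, x₂ - u v₂) > ε₀`). Appendix B (p. 28, chunk p0028) proves it: coming
`ε`-close forces
`u (v₁ - v₂) ∈ ⋃_{k ∈ ℤ^d} B_{3ā}(x₁⁰ - x₂⁰ + k) ∩ B(0, 2Et)`, "in other words, `v₁ - v₂` has to
belong to a finite union of cones of vertex `0`, at most one of which is of solid angle
`(ā/ε₀)^{d-1}`; the other ones (at most `(4Et)^d`) are of solid angle `c ā^{d-1}`".

This file PROVES, with explicit constants:

* `measure_setOf_ray_meets_closedBall_le` (`…_of_le`) — **the cone estimate** in any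
  finite-dimensional real normed space with an additive Haar measure: for `0 < r`, `2r ≤ ‖p‖`,
  `0 < W`, the set of `w` with `‖w‖ ≤ W` whose ray `{u • w : u ≥ 0}` meets `closedBall p r` has
  measure `≤ 2 (‖p‖/r) (6Wr/‖p‖)^{dim} μ(B₁) ≤ 2·6^{dim} W^{dim} (r/ℓ)^{dim-1} μ(B₁)` for
  `2r ≤ ℓ ≤ ‖p‖` (no solid angles in Mathlib: such a `w` is `λ q`, `q ∈ closedBall p r`,
  `0 ≤ λ ≤ Λ := 2W/‖p‖`; cutting `[0, Λ]` into `n = ⌈‖p‖/r⌉` pieces, each piece of the cone lies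
  in a ball of radius `3Λr`, `setOf_ray_meets_closedBall_subset`).
* `setOf_norm_add_latticeVec_le_subset`, `card_piFinset_Icc_le`,
  `finite_setOf_norm_add_latticeVec_le` — **lattice translates within reach**: the `k ∈ ℤ^d` with
  `‖p + k‖ ≤ ρ` lie in a box of at most `(2ρ + 1)^d` points.
* `half_le_norm_reprSym_add_latticeVec` — a nonzero lattice translate of a minimal-image vector
  (`Torus.reprSym`, coordinates in `(-1/2, 1/2]`) has norm `≥ 1/2`;
  `exists_reprSym_eq_add_latticeVec` — the minimal image of `proj a` is a lattice translate of
  `a`.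
* `bgsr_lemma52_avoid` — **Lemma 5.2, first bullet, avoidance**: with
  `p₀ = reprSym (x₁⁰ - x₂⁰)` and the bad set
  `K = {w : ‖w‖ ≤ W, ∃ k ∈ ℤ^d, ‖p₀ + k‖ ≤ tW + 3ā, ∃ u ≥ 0, ‖u w - (p₀ + k)‖ ≤ 3ā}`, if
  `euclidDist xᵢ xᵢ⁰ ≤ ā`, `‖v₁ - v₂‖ ≤ W`, `ε ≤ ā` and `v₁ - v₂ ∉ K`, then
  `euclidDist (x₁ - proj (u v₁)) (x₂ - proj (u v₂)) > ε` for all `0 ≤ u ≤ t` (the free flight of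
  `Torus.geometry` is `x + proj (s v)`).
* `bgsr_lemma52_volume` — **Lemma 5.2, first bullet, size of `K`**: for `0 < ā ≤ 1/12`,
  `6ā ≤ ε₀ ≤ euclidDist x₁⁰ x₂⁰`, `0 < W`, `0 ≤ t`:
  `|K| ≤ 2·6^d W^d ((3ā/ε₀)^{d-1} + (2tW + 2)^d (6ā)^{d-1}) |B₁|` — the printed
  `C E^d ((ā/ε₀)^{d-1} + (Et)^d ā^{d-1})` with `W = 2E`, where the count of translates within
  reach is the honest `(2tW + 2)^d ≥ 1` (the printed `(Et)^d` presumes `Et ≳ 1`).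

And, for the second bullet (Appendix B: for the translates with `|x₁⁰ - x₂⁰ + k| ≥ 1/4` "some
cone of vertex `0` and solid angle `ε₀^{d-1}`"; for the nearest one, "denoting by `n` any unit
vector normal to `x̄₁ - x̄₂ + k`, … `u |(v₁ - v₂)·n| ≤ 3ε₀` from which we deduce that `v₁ - v₂`
belongs to the intersection of `B_{2E}(0)` and some cylinder of radius `ε₀/δ`") — here the
cylinder serves the nearest image `k = 0` whatever its length and the cones all `k ≠ 0`:

* `mul_norm_sub_inner_smul_le` — Pythagoras along a unit vector `e`:
  `u ‖w - ⟪w, e⟫ e‖ ≤ ‖u • w - c • e‖`, whence the cylinder of radius `3ε₀/δ` for `u ≥ δ`.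
* `measure_setOf_norm_sub_inner_smul_le` — **the tube estimate** in a finite-dimensional real
  inner product space with an additive Haar measure: for a unit vector `e` and `0 < s ≤ W`, the
  `w` with `‖w‖ ≤ W` at distance `≤ s` from the axis `ℝe` have measure
  `≤ 3·2^{dim} W s^{dim-1} μ(B₁)` (cover by `≤ W/s + 2` balls of radius `2s` centred on the axis,
  `setOf_norm_sub_inner_smul_le_subset`).
* `exists_latticeVec_of_euclidDist_freeFlight_le` — the lifting step common to both bullets:
  if the free flights come `ε`-close at time `u ≥ 0` then for some `k ∈ ℤ^d`,
  `‖u(v₁ - v₂) - (p₀ + k)‖ ≤ ε + 2ā` and `‖p₀ + k‖ ≤ u ‖v₁ - v₂‖ + ε + 2ā`.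
* `bgsr_lemma52_delta_avoid` — **Lemma 5.2, second bullet, avoidance**: with the bad set
  `K_δ = {w : ‖w‖ ≤ W, (∃ u ≥ δ, ‖uw - p₀‖ ≤ 3ε₀) ∨ (∃ k ≠ 0, ‖p₀ + k‖ ≤ tW + 3ε₀,
  ∃ u ≥ 0, ‖uw - (p₀ + k)‖ ≤ 3ε₀)}`: if `euclidDist xᵢ xᵢ⁰ ≤ ā ≤ ε₀`, `‖v₁ - v₂‖ ≤ W`,
  `v₁ - v₂ ∉ K_δ` and `max(0, δ) ≤ u ≤ t`, then
  `euclidDist (x₁ - proj (u v₁)) (x₂ - proj (u v₂)) > ε₀`.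
* `bgsr_lemma52_delta_volume` — **Lemma 5.2, second bullet, size of `K_δ`**: for
  `0 < ε₀ ≤ 1/12`, `0 < δ`, `3ε₀/δ ≤ W`, `0 ≤ t`, `ε₀ ≤ euclidDist x₁⁰ x₂⁰`:
  `|K_δ| ≤ (3·2^d W (3ε₀/δ)^{d-1} + (2tW + 2)^d · 2·6^d W^d (6ε₀)^{d-1}) |B₁|` — the printed
  `C E ((ε₀/δ)^{d-1} + (Et)^d E^{d-1} ε₀^{d-1})` with `W = 2E` (and `(2tW+2)^d` for `(Et)^d`).

In the statements the reference positions `x₁⁰, x₂⁰` are called `y₁, y₂`.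

## References

* T. Bodineau, I. Gallagher, L. Saint-Raymond, *The Brownian motion as the limit of a
  deterministic system of hard-spheres*, Invent. Math. 203 (2016) 493–553 = arXiv:1305.3397v2,
  Lemma 5.2 (p. 17) and Appendix B (p. 28 of the held text).
* I. Gallagher, L. Saint-Raymond, B. Texier, *From Newton to Boltzmann: hard spheres and
  short-range potentials*, EMS (2013), arXiv:1208.5753, Lemma 12.2.1 (the whole-space version).
-/

open MeasureTheory Metric Set

namespace Literature.MathematicalPhysics.KineticTheory

noncomputable section

section Cone

variable {E : Type*} [NormedAddCommGroup E] [NormedSpace ℝ E] [FiniteDimensional ℝ E]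
  [MeasurableSpace E] [BorelSpace E]

omit [FiniteDimensional ℝ E] [MeasurableSpace E] [BorelSpace E] in
/-- **Covering of a thin cone by balls.** If `0 < r`, `2r ≤ ‖p‖` and `0 < W`, every `w` with
`‖w‖ ≤ W` whose ray `u ↦ u • w` (`u ≥ 0`) meets `closedBall p r` lies in one of the
`n = ⌈‖p‖/r⌉` balls `closedBall ((i Λ/n) • p) (3Λr)`, `i < n`, `Λ = 2W/‖p‖`
(write `w = λ q`, `q ∈ closedBall p r`, `0 < λ ≤ Λ`, and take `i = ⌊λ n/Λ⌋ ∧ (n-1)`).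
[folklore] -/
theorem setOf_ray_meets_closedBall_subset (p : E) {r W : ℝ} (hr : 0 < r) (hpr : 2 * r ≤ ‖p‖)
    (hW : 0 < W) :
    {w : E | ‖w‖ ≤ W ∧ ∃ u : ℝ, 0 ≤ u ∧ ‖u • w - p‖ ≤ r} ⊆
      ⋃ i ∈ Finset.range ⌈‖p‖ / r⌉₊,
        closedBall (((i : ℝ) * (2 * W / ‖p‖) / ⌈‖p‖ / r⌉₊) • p) (3 * (2 * W / ‖p‖) * r) := by
  have hp0 : 0 < ‖p‖ := by linarith
  set Λ : ℝ := 2 * W / ‖p‖ with hΛ_def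
  have hΛ0 : 0 < Λ := by positivity
  set n : ℕ := ⌈‖p‖ / r⌉₊ with hn_def
  have hpr2 : 2 ≤ ‖p‖ / r := by
    rw [le_div_iff₀ hr]
    linarith
  have hn2 : (2 : ℝ) ≤ n := hpr2.trans (Nat.le_ceil _)
  have hn0' : (0 : ℝ) < n := by linarith
  have hn0 : 0 < n := by exact_mod_cast hn0'
  have hn1 : 1 ≤ n := hn0
  have hnr : ‖p‖ / n ≤ r := by
    rw [div_le_iff₀ hn0']
    have h : ‖p‖ / r ≤ n := Nat.le_ceil _
    rw [div_le_iff₀ hr] at h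
    linarith
  intro w hw
  obtain ⟨hwW, u, hu0, huw⟩ := hw
  -- `q = u • w` is in the ball, hence far from `0`, so `u > 0` and `w = u⁻¹ • q`
  have hq_norm : ‖p‖ - r ≤ ‖u • w‖ := by
    have h1 := norm_sub_norm_le p (u • w)
    have h2 : ‖p - u • w‖ ≤ r := by
      rw [norm_sub_rev]
      exact huw
    linarith
  have hq0 : 0 < ‖u • w‖ := by linarith
  have hu_pos : 0 < u := by
    rcases hu0.lt_or_eq with h | h
    · exact h
    · exfalso
      rw [← h, zero_smul, norm_zero] at hq0
      exact lt_irrefl _ hq0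
  set lam : ℝ := u⁻¹ with hlam_def
  have hlam0 : 0 < lam := inv_pos.2 hu_pos
  have hw_eq : w = lam • (u • w) := by
    rw [smul_smul, hlam_def, inv_mul_cancel₀ hu_pos.ne', one_smul]
  have hlamΛ : lam ≤ Λ := by
    have h1 : lam * ‖u • w‖ = ‖w‖ := by
      conv_rhs => rw [hw_eq, norm_smul, Real.norm_of_nonneg hlam0.le]
    have h3 : ‖p‖ / 2 ≤ ‖u • w‖ := by linarith
    rw [hΛ_def, le_div_iff₀ hp0]
    nlinarith
  -- the index `i`
  set i : ℕ := min ⌊lam * n / Λ⌋₊ (n - 1) with hi_def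
  have hi_lt : i < n := lt_of_le_of_lt (min_le_right _ _) (Nat.sub_lt hn0 one_pos)
  set lami : ℝ := (i : ℝ) * Λ / n with hlami_def
  have hlami0 : 0 ≤ lami := by positivity
  have hlami_le : lami ≤ lam := by
    have h1 : (i : ℝ) ≤ lam * n / Λ :=
      (Nat.cast_le.2 (min_le_left _ _)).trans (Nat.floor_le (by positivity))
    rw [le_div_iff₀ hΛ0] at h1
    rw [hlami_def, div_le_iff₀ hn0']
    linarith
  have hlamiΛ : lami ≤ Λ := by
    rw [hlami_def, div_le_iff₀ hn0']
    have : (i : ℝ) ≤ n := by exact_mod_cast hi_lt.le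
    nlinarith
  have hlam_sub : lam - lami ≤ Λ / n := by
    rcases lt_or_ge ⌊lam * n / Λ⌋₊ (n - 1) with hlt | hge
    · have hi_eq : i = ⌊lam * n / Λ⌋₊ := min_eq_left hlt.le
      have h1 : lam * n / Λ < i + 1 := by
        rw [hi_eq]
        exact Nat.lt_floor_add_one _
      rw [div_lt_iff₀ hΛ0] at h1
      rw [hlami_def, sub_le_iff_le_add, ← add_div, le_div_iff₀ hn0']
      linarith
    · have hi_eq : i = n - 1 := min_eq_right hge
      have hcast : (i : ℝ) = n - 1 := by
        rw [hi_eq, Nat.cast_sub hn1, Nat.cast_one]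
      rw [hlami_def, hcast]
      have : lam - (↑n - 1) * Λ / ↑n = lam - Λ + Λ / n := by
        field_simp
        ring
      rw [this]
      linarith
  -- the distance estimate
  have hmem : w ∈ closedBall (lami • p) (3 * Λ * r) := by
    rw [mem_closedBall, dist_eq_norm]
    have hsplit : w - lami • p = lami • (u • w - p) + (lam - lami) • (u • w) := by
      conv_lhs => rw [hw_eq]
      simp only [smul_sub, sub_smul]
      abel
    rw [hsplit]
    have hqle : ‖u • w‖ ≤ ‖p‖ + r := by
      have h1 := norm_le_norm_add_norm_sub' (u • w) p
      rw [norm_sub_rev] at h1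
      linarith [norm_sub_rev (u • w) p]
    calc ‖lami • (u • w - p) + (lam - lami) • (u • w)‖
        ≤ ‖lami • (u • w - p)‖ + ‖(lam - lami) • (u • w)‖ := norm_add_le _ _
      _ = lami * ‖u • w - p‖ + (lam - lami) * ‖u • w‖ := by
          rw [norm_smul, norm_smul, Real.norm_of_nonneg hlami0,
            Real.norm_of_nonneg (by linarith)]
      _ ≤ Λ * r + Λ / n * (‖p‖ + r) :=
          add_le_add (mul_le_mul hlamiΛ huw (norm_nonneg _) hΛ0.le)
            (mul_le_mul hlam_sub hqle (norm_nonneg _) (by positivity))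
      _ = Λ * r + Λ * (‖p‖ / n) + Λ / n * r := by
          field_simp
          ring
      _ ≤ Λ * r + Λ * r + Λ * r := by
          refine add_le_add (add_le_add le_rfl (mul_le_mul_of_nonneg_left hnr hΛ0.le)) ?_
          rw [div_mul_eq_mul_div, div_le_iff₀ hn0']
          have h1n : (1 : ℝ) ≤ n := by exact_mod_cast hn1
          have hΛr : 0 ≤ Λ * r := by positivity
          nlinarith [mul_le_mul_of_nonneg_left h1n hΛr]
      _ = 3 * Λ * r := by ring
  exact mem_iUnion₂.2 ⟨i, Finset.mem_range.2 hi_lt, hmem⟩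

/-- **The cone estimate** (GSRT 2013 Lemma 12.2.1, BGSR 2016 App. B: "a cone of vertex `0`
and solid angle `(ā/ε₀)^{d-1}`", intersected with a ball of velocities). For an additive Haar
measure `μ` on a finite-dimensional real normed space, `0 < r`, `2r ≤ ‖p‖` and `0 < W`: the
set of `w` with `‖w‖ ≤ W` whose ray `u ↦ u • w` (`u ≥ 0`) meets `closedBall p r` has measure at
most `2 (‖p‖/r) (6 W r/‖p‖)^{dim E} μ(ball 0 1)` — that is
`2 · 6^{dim} μ(B₁) · W^{dim} (r/‖p‖)^{dim - 1}`, the printed `C E^d (ā/ε₀)^{d-1}` with `W = 2E`,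
`r = 3ā`, `‖p‖ ≥ ε₀`. [cite: GallagherSaintRaymondTexier2013, Lemma 12.2.1] -/
theorem measure_setOf_ray_meets_closedBall_le (μ : Measure E) [μ.IsAddHaarMeasure] (p : E)
    {r W : ℝ} (hr : 0 < r) (hpr : 2 * r ≤ ‖p‖) (hW : 0 < W) :
    μ {w : E | ‖w‖ ≤ W ∧ ∃ u : ℝ, 0 ≤ u ∧ ‖u • w - p‖ ≤ r} ≤
      ENNReal.ofReal (2 * (‖p‖ / r) * (6 * W * r / ‖p‖) ^ Module.finrank ℝ E) *
        μ (ball (0 : E) 1) := by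
  have hp0 : 0 < ‖p‖ := by linarith
  set Λ : ℝ := 2 * W / ‖p‖ with hΛ_def
  have hΛ0 : 0 < Λ := by positivity
  set n : ℕ := ⌈‖p‖ / r⌉₊ with hn_def
  have hpr0 : 0 ≤ ‖p‖ / r := by positivity
  have hpr2 : 2 ≤ ‖p‖ / r := by
    rw [le_div_iff₀ hr]
    linarith
  have hnr : (n : ℝ) ≤ 2 * (‖p‖ / r) :=
    (Nat.ceil_lt_add_one hpr0).le.trans (by linarith)
  have hρ0 : 0 ≤ 3 * Λ * r := by positivity
  have hρ : 3 * Λ * r = 6 * W * r / ‖p‖ := by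
    rw [hΛ_def]
    field_simp
    ring
  calc μ {w : E | ‖w‖ ≤ W ∧ ∃ u : ℝ, 0 ≤ u ∧ ‖u • w - p‖ ≤ r}
      ≤ μ (⋃ i ∈ Finset.range n, closedBall (((i : ℝ) * Λ / n) • p) (3 * Λ * r)) :=
        measure_mono (setOf_ray_meets_closedBall_subset p hr hpr hW)
    _ ≤ ∑ i ∈ Finset.range n, μ (closedBall (((i : ℝ) * Λ / n) • p) (3 * Λ * r)) :=
        measure_biUnion_finset_le _ _
    _ = ∑ _i ∈ Finset.range n,
          ENNReal.ofReal ((3 * Λ * r) ^ Module.finrank ℝ E) * μ (ball (0 : E) 1) :=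
        Finset.sum_congr rfl fun i _ => Measure.addHaar_closedBall μ _ hρ0
    _ = (n : ENNReal) *
          (ENNReal.ofReal ((3 * Λ * r) ^ Module.finrank ℝ E) * μ (ball (0 : E) 1)) := by
        rw [Finset.sum_const, Finset.card_range, nsmul_eq_mul]
    _ = ENNReal.ofReal ((n : ℝ) * (6 * W * r / ‖p‖) ^ Module.finrank ℝ E) *
          μ (ball (0 : E) 1) := by
        rw [← mul_assoc, hρ, ENNReal.ofReal_mul (Nat.cast_nonneg n), ENNReal.ofReal_natCast]
    _ ≤ ENNReal.ofReal (2 * (‖p‖ / r) * (6 * W * r / ‖p‖) ^ Module.finrank ℝ E) *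
          μ (ball (0 : E) 1) := by
        gcongr

/-- **The cone estimate, monotone form**: under `2r ≤ ℓ ≤ ‖p‖`, `0 < r`, `0 < W` and
`1 ≤ dim E`, the measure of the set of `w`, `‖w‖ ≤ W`, whose ray meets `closedBall p r` is at
most `2 · 6^{dim} W^{dim} (r/ℓ)^{dim-1} μ(ball 0 1)` — the solid-angle bound `C W^d (r/ℓ)^{d-1}`
of GSRT Lemma 12.2.1 / BGSR App. B with an explicit constant.
[cite: GallagherSaintRaymondTexier2013, Lemma 12.2.1] -/
theorem measure_setOf_ray_meets_closedBall_le_of_le (μ : Measure E) [μ.IsAddHaarMeasure]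
    (p : E) {r W ℓ : ℝ} (hr : 0 < r) (hℓr : 2 * r ≤ ℓ) (hℓ : ℓ ≤ ‖p‖) (hW : 0 < W)
    (hm : 1 ≤ Module.finrank ℝ E) :
    μ {w : E | ‖w‖ ≤ W ∧ ∃ u : ℝ, 0 ≤ u ∧ ‖u • w - p‖ ≤ r} ≤
      ENNReal.ofReal (2 * 6 ^ Module.finrank ℝ E * W ^ Module.finrank ℝ E *
          (r / ℓ) ^ (Module.finrank ℝ E - 1)) * μ (ball (0 : E) 1) := by
  have hℓ0 : 0 < ℓ := by linarith
  have hp0 : 0 < ‖p‖ := by linarith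
  obtain ⟨j, hj⟩ : ∃ j : ℕ, Module.finrank ℝ E = j + 1 := ⟨_, (Nat.succ_pred_eq_of_pos hm).symm⟩
  refine (measure_setOf_ray_meets_closedBall_le μ p hr (hℓr.trans hℓ) hW).trans
    (mul_le_mul_of_nonneg_right (ENNReal.ofReal_le_ofReal ?_) bot_le)
  rw [hj, Nat.add_sub_cancel, pow_succ, pow_succ, pow_succ]
  have h1 : 6 * W * r / ‖p‖ ≤ 6 * W * r / ℓ :=
    div_le_div_of_nonneg_left (by positivity) hℓ0 hℓ
  have h2 : (6 * W * r / ‖p‖) ^ j ≤ (6 * W * r / ℓ) ^ j :=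
    pow_le_pow_left₀ (by positivity) h1 j
  have h3 : (6 * W * r / ℓ) ^ j = 6 ^ j * W ^ j * (r / ℓ) ^ j := by
    rw [← mul_pow, ← mul_pow]
    congr 1
    field_simp
  calc 2 * (‖p‖ / r) * ((6 * W * r / ‖p‖) ^ j * (6 * W * r / ‖p‖))
      = 2 * 6 * W * (6 * W * r / ‖p‖) ^ j := by
        field_simp
    _ ≤ 2 * 6 * W * (6 * W * r / ℓ) ^ j := by gcongr
    _ = 2 * (6 ^ j * 6) * (W ^ j * W) * (r / ℓ) ^ j := by
        rw [h3]
        ring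

end Cone

/-! ## Lattice points in a ball -/

section Lattice

open Literature.Analysis.FunctionSpaces

variable {d : Type*} [Fintype d] [DecidableEq d]

/-- **Lattice points of `ℤ^d` in a Euclidean ball.** The translates `k ∈ ℤ^d` with
`‖p + k‖ ≤ ρ` all lie in the box `∏ᵢ [⌈-pᵢ - ρ⌉, ⌊-pᵢ + ρ⌋]` (each coordinate of a vector is at
most its Euclidean norm). [folklore] -/
theorem setOf_norm_add_latticeVec_le_subset (p : EuclideanSpace ℝ d) (ρ : ℝ) :
    {k : d → ℤ | ‖p + Torus.latticeVec k‖ ≤ ρ} ⊆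
      (Fintype.piFinset fun i => Finset.Icc ⌈-p i - ρ⌉ ⌊-p i + ρ⌋ : Set (d → ℤ)) := by
  intro k hk
  rw [Finset.mem_coe, Fintype.mem_piFinset]
  intro i
  have hi : |p i + k i| ≤ ρ := by
    have h := PiLp.norm_apply_le (p + Torus.latticeVec k) i
    rw [Real.norm_eq_abs] at h
    have h' : (p + Torus.latticeVec k) i = p i + k i := by
      rw [PiLp.add_apply, Torus.latticeVec_apply]
    rw [h'] at h
    exact h.trans hk
  rw [abs_le] at hi
  rw [Finset.mem_Icc, Int.ceil_le, Int.le_floor]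
  constructor <;> push_cast <;> linarith [hi.1, hi.2]

/-- **Counting lattice points in a ball**: the number of `k ∈ ℤ^d` with `‖p + k‖ ≤ ρ`
(`ρ ≥ 0`) is at most `(2ρ + 1)^d` (BGSR App. B: "the other ones (at most `(4Et)^d`)").
[folklore] -/
theorem card_piFinset_Icc_le (p : EuclideanSpace ℝ d) {ρ : ℝ} (hρ : 0 ≤ ρ) :
    ((Fintype.piFinset fun i => Finset.Icc ⌈-p i - ρ⌉ ⌊-p i + ρ⌋).card : ℝ) ≤
      (2 * ρ + 1) ^ Fintype.card d := by
  rw [Fintype.card_piFinset, Nat.cast_prod, ← Finset.card_univ, ← Finset.prod_const]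
  refine Finset.prod_le_prod (fun i _ => Nat.cast_nonneg _) fun i _ => ?_
  rw [Int.card_Icc, ← Int.cast_natCast, Int.toNat_eq_max, Int.cast_max, Int.cast_zero]
  refine max_le ?_ (by positivity)
  push_cast
  have h2 : ((⌊-p i + ρ⌋ : ℤ) : ℝ) ≤ -p i + ρ := Int.floor_le _
  have h3 : -p i - ρ ≤ ((⌈-p i - ρ⌉ : ℤ) : ℝ) := Int.le_ceil _
  linarith

/-- The set of `k ∈ ℤ^d` with `‖p + k‖ ≤ ρ` is finite. [folklore] -/
theorem finite_setOf_norm_add_latticeVec_le (p : EuclideanSpace ℝ d) (ρ : ℝ) :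
    {k : d → ℤ | ‖p + Torus.latticeVec k‖ ≤ ρ}.Finite :=
  (Finset.finite_toSet _).subset (setOf_norm_add_latticeVec_le_subset p ρ)

end Lattice

/-! ## BGSR Lemma 5.2 (first half) on the flat torus -/

section TorusLemma

open Literature.Analysis.FunctionSpaces Literature.Analysis.FunctionSpaces.Torus
open Literature.Analysis.FluidPDE Literature.Analysis.FluidPDE.Torus

variable {d : Type*} [Fintype d] [DecidableEq d]

/-- **The minimal image is a lattice translate**: if `proj a = y` then
`reprSym y = a + k` for some `k ∈ ℤ^d`, so that `‖a + k‖ = ‖reprSym y‖` is the minimal-image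
distance of `y` to `0` (GST 2013 Ch. 4 intro; `proj_eq_proj_iff`). [folklore] -/
theorem exists_reprSym_eq_add_latticeVec (a : EuclideanSpace ℝ d) :
    ∃ k : d → ℤ, reprSym (proj a) = a + latticeVec k :=
  (proj_eq_proj_iff_holds a (reprSym (proj a))).1 (proj_reprSym (proj a)).symm

/-- A nonzero lattice translate of a minimal-image vector has norm at least `1/2`: the
coordinates of `reprSym y` lie in `(-1/2, 1/2]`, so `|reprSym y i + k i| ≥ 1/2` wherever
`k i ≠ 0` (BGSR App. B: "`|y₁ - y₂ + k| ≤ 1/4` … can happen only for one value of `k`").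
[folklore] -/
theorem half_le_norm_reprSym_add_latticeVec (y : UnitAddTorus d) {k : d → ℤ} (hk : k ≠ 0) :
    (1 / 2 : ℝ) ≤ ‖reprSym y + latticeVec k‖ := by
  obtain ⟨i, hi⟩ : ∃ i, k i ≠ 0 := by
    by_contra h
    push Not at h
    exact hk (funext h)
  have hmem := reprSym_apply_mem_Ioc y i
  have hki : (1 : ℝ) ≤ |(k i : ℝ)| := by
    rw [← Int.cast_abs]
    exact_mod_cast Int.one_le_abs hi
  have hcoord : (1 / 2 : ℝ) ≤ |reprSym y i + k i| := by
    rcases le_abs'.1 hki with h | h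
    · rw [le_abs']
      left
      linarith [hmem.2]
    · rw [le_abs']
      right
      linarith [hmem.1]
  calc (1 / 2 : ℝ) ≤ |reprSym y i + k i| := hcoord
    _ = ‖(reprSym y + latticeVec k) i‖ := by
        rw [Real.norm_eq_abs, PiLp.add_apply, latticeVec_apply]
    _ ≤ ‖reprSym y + latticeVec k‖ := PiLp.norm_apply_le _ i

/-- **BGSR Lemma 5.2, first half — avoidance** (arXiv:1305.3397v2 Lemma 5.2 and Appendix B,
first bullet). On the flat torus `T^d` with the minimal-image distance `euclidDist`, let
`y₁, y₂` be reference positions with minimal-image separation vector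
`p₀ = reprSym (y₁ - y₂)`, let `x₁, x₂` be `ā`-close to them, `‖v₁ - v₂‖ ≤ W`, `ε ≤ ā`, and
`0 ≤ u ≤ t`. If the free flights `x₁ - u v₁`, `x₂ - u v₂` come `ε`-close, then (lifting to
`ℝ^d`) `u (v₁ - v₂) ∈ B_{3ā}(p₀ + k)` for a lattice translate with `‖p₀ + k‖ ≤ tW + 3ā`
("by the triangular inequality and provided that `ε < ā`,
`(x₁⁰ - v₁u) - (x₂⁰ - v₂u) ∈ ⋃_k B_{3ā}(k)` … `s(v₁ - v₂) ∈ (⋃_k B_{3ā}(x₁⁰ - x₂⁰ + k)) ∩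
B_0(2Et)`"; the paper's `x₁⁰, x₂⁰` are `y₁, y₂` here). Contrapositive form: outside the bad set
`K = {w : ‖w‖ ≤ W, ∃ k, ‖p₀ + k‖ ≤ tW + 3ā, ∃ u ≥ 0, ‖u w - (p₀ + k)‖ ≤ 3ā}` of relative
velocities, the two particles stay at distance `> ε` on `[0, t]`.
[cite: BodineauGallagherSaintRaymondInvent2016, Lemma 5.2 and Appendix B] -/
theorem bgsr_lemma52_avoid {t ā ε W u : ℝ} (hεā : ε ≤ ā) {y₁ y₂ x₁ x₂ : UnitAddTorus d}
    {v₁ v₂ : EuclideanSpace ℝ d} (hx₁ : euclidDist x₁ y₁ ≤ ā) (hx₂ : euclidDist x₂ y₂ ≤ ā)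
    (hvW : ‖v₁ - v₂‖ ≤ W) (hu0 : 0 ≤ u) (hut : u ≤ t)
    (hK : v₁ - v₂ ∉ {w : EuclideanSpace ℝ d | ‖w‖ ≤ W ∧ ∃ k : d → ℤ,
        ‖reprSym (y₁ - y₂) + latticeVec k‖ ≤ t * W + 3 * ā ∧
        ∃ u : ℝ, 0 ≤ u ∧ ‖u • w - (reprSym (y₁ - y₂) + latticeVec k)‖ ≤ 3 * ā}) :
    ε < euclidDist (x₁ - proj (u • v₁)) (x₂ - proj (u • v₂)) := by
  by_contra hle
  push Not at hle
  set p₀ := reprSym (y₁ - y₂) with hp₀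
  set e₁ := reprSym (x₁ - y₁) with he₁
  set e₂ := reprSym (x₂ - y₂) with he₂
  set w := v₁ - v₂ with hw
  set q := p₀ + e₁ - e₂ - u • w with hq
  have hW0 : 0 ≤ W := (norm_nonneg _).trans hvW
  -- the difference of the two free flights is the projection of `q`
  have hdiff : (x₁ - proj (u • v₁)) - (x₂ - proj (u • v₂)) = proj q := by
    have h1 : proj p₀ = y₁ - y₂ := proj_reprSym _
    have h2 : proj e₁ = x₁ - y₁ := proj_reprSym _
    have h3 : proj e₂ = x₂ - y₂ := proj_reprSym _
    -- `proj` is additive (`proj_sub` of `TorusConvolution` is this `rfl`, not imported here)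
    have hps : ∀ a b : EuclideanSpace ℝ d, proj (a - b) = proj a - proj b := fun _ _ => rfl
    rw [hq, hps, hps, proj_add, h1, h2, h3, hw, smul_sub, hps]
    abel
  -- the minimal image of `proj q` is a lattice translate of `q`, of norm `≤ ε`
  obtain ⟨k, hk⟩ := exists_reprSym_eq_add_latticeVec q
  have hqk : ‖q + latticeVec k‖ ≤ ε := by
    rw [← hk, ← hdiff]
    exact hle
  -- hence `u w` is `3ā`-close to the translate `p₀ + k`, which is therefore within reach
  have he₁n : ‖e₁‖ ≤ ā := hx₁
  have he₂n : ‖e₂‖ ≤ ā := hx₂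
  have hclose : ‖u • w - (p₀ + latticeVec k)‖ ≤ 3 * ā := by
    have hsplit : u • w - (p₀ + latticeVec k) = -(q + latticeVec k) + e₁ - e₂ := by
      rw [hq]
      abel
    rw [hsplit]
    calc ‖-(q + latticeVec k) + e₁ - e₂‖ ≤ ‖-(q + latticeVec k) + e₁‖ + ‖e₂‖ := norm_sub_le _ _
      _ ≤ ‖-(q + latticeVec k)‖ + ‖e₁‖ + ‖e₂‖ := by gcongr; exact norm_add_le _ _
      _ ≤ ε + ā + ā := by rw [norm_neg]; gcongr
      _ ≤ 3 * ā := by linarith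
  have hfar : ‖p₀ + latticeVec k‖ ≤ t * W + 3 * ā := by
    have h1 : ‖p₀ + latticeVec k‖ ≤ ‖u • w‖ + ‖u • w - (p₀ + latticeVec k)‖ := by
      have := norm_sub_le (u • w) (u • w - (p₀ + latticeVec k))
      rwa [sub_sub_cancel] at this
    have h2 : ‖u • w‖ ≤ t * W := by
      rw [norm_smul, Real.norm_of_nonneg hu0]
      exact mul_le_mul hut hvW (norm_nonneg _) (hu0.trans hut)
    linarith
  exact hK ⟨hvW, k, hfar, u, hu0, hclose⟩

/-- **BGSR Lemma 5.2, first half — the size of the bad set** (arXiv:1305.3397v2 Lemma 5.2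
and Appendix B: "`v₁ - v₂` has to belong to a finite union of cones of vertex `0`, at most one
of which is of solid angle `(ā/ε₀)^{d-1}`; the other ones (at most `(4Et)^d`) are of solid angle
`c ā^{d-1}`. The intersection `K(x̄₁ - x̄₂, ε₀, ā)` of these cones and of the sphere of radius `2E`
is of size `|K| ≤ C E^d ((ā/ε₀)^{d-1} + (Et)^d ā^{d-1})`"). Here, with `W` for `2E`, `y₁, y₂` for
the paper's `x₁⁰, x₂⁰`, explicit constants and the honest factor `(2tW + 2)^d` counting the
lattice translates within reach (the printed `(Et)^d` presumes `Et ≳ 1`): if `0 < ā ≤ 1/12`,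
`6ā ≤ ε₀ ≤ euclidDist y₁ y₂`, `0 < W`, `0 ≤ t`, the bad set of `bgsr_lemma52_avoid` has volume
at most
`2·6^d W^d ((3ā/ε₀)^{d-1} + (2tW + 2)^d (6ā)^{d-1}) |B₁|`.
[cite: BodineauGallagherSaintRaymondInvent2016, Lemma 5.2 and Appendix B] -/
theorem bgsr_lemma52_volume {t ā ε₀ W : ℝ} (hā : 0 < ā) (hā12 : ā ≤ 1 / 12) (hW : 0 < W)
    (ht : 0 ≤ t) (hd : 1 ≤ Fintype.card d) {y₁ y₂ : UnitAddTorus d} (hε₀ : 6 * ā ≤ ε₀)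
    (hsep : ε₀ ≤ euclidDist y₁ y₂) :
    volume {w : EuclideanSpace ℝ d | ‖w‖ ≤ W ∧ ∃ k : d → ℤ,
        ‖reprSym (y₁ - y₂) + latticeVec k‖ ≤ t * W + 3 * ā ∧
        ∃ u : ℝ, 0 ≤ u ∧ ‖u • w - (reprSym (y₁ - y₂) + latticeVec k)‖ ≤ 3 * ā} ≤
      ENNReal.ofReal (2 * 6 ^ Fintype.card d * W ^ Fintype.card d *
          ((3 * ā / ε₀) ^ (Fintype.card d - 1) +
            (2 * (t * W) + 2) ^ Fintype.card d * (6 * ā) ^ (Fintype.card d - 1))) *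
        volume (ball (0 : EuclideanSpace ℝ d) 1) := by
  classical
  set n := Fintype.card d with hn_def
  have hn : Module.finrank ℝ (EuclideanSpace ℝ d) = n := finrank_euclideanSpace
  set p₀ := reprSym (y₁ - y₂) with hp₀_def
  set ρ : ℝ := t * W + 3 * ā with hρ_def
  have hρ0 : 0 ≤ ρ := by positivity
  set r : ℝ := 3 * ā with hr_def
  have hr : 0 < r := by positivity
  set V := volume (ball (0 : EuclideanSpace ℝ d) 1) with hV_def
  set a₀ : ℝ := 2 * 6 ^ n * W ^ n * (r / ε₀) ^ (n - 1) with ha₀_def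
  set a₁ : ℝ := 2 * 6 ^ n * W ^ n * (r / (1 / 2)) ^ (n - 1) with ha₁_def
  have ha₀0 : 0 ≤ a₀ := by
    have : 0 ≤ r / ε₀ := div_nonneg hr.le (by linarith)
    positivity
  have ha₁0 : 0 ≤ a₁ := by positivity
  -- the cones
  set C : (d → ℤ) → Set (EuclideanSpace ℝ d) := fun k =>
    {w | ‖w‖ ≤ W ∧ ∃ u : ℝ, 0 ≤ u ∧ ‖u • w - (p₀ + latticeVec k)‖ ≤ r} with hC_def
  have hfin := finite_setOf_norm_add_latticeVec_le p₀ ρ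
  set S : Finset (d → ℤ) := hfin.toFinset with hS_def
  have hcover : {w : EuclideanSpace ℝ d | ‖w‖ ≤ W ∧ ∃ k : d → ℤ,
      ‖p₀ + latticeVec k‖ ≤ ρ ∧ ∃ u : ℝ, 0 ≤ u ∧ ‖u • w - (p₀ + latticeVec k)‖ ≤ r} ⊆
      ⋃ k ∈ S, C k := by
    intro w hw
    obtain ⟨hwW, k, hk, u, hu, huw⟩ := hw
    refine mem_iUnion₂.2 ⟨k, ?_, hwW, u, hu, huw⟩
    rw [hS_def, Set.Finite.mem_toFinset]
    exact hk
  -- each cone is small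
  have hC0 : volume (C 0) ≤ ENNReal.ofReal a₀ * V := by
    have hp : ε₀ ≤ ‖p₀ + latticeVec 0‖ := by
      rw [latticeVec_zero, add_zero]
      exact hsep
    have h := measure_setOf_ray_meets_closedBall_le_of_le volume (p₀ + latticeVec 0) hr
      (by linarith : 2 * r ≤ ε₀) hp hW (hn ▸ hd)
    rw [hn] at h
    exact h
  have hCk : ∀ k : d → ℤ, k ≠ 0 → volume (C k) ≤ ENNReal.ofReal a₁ * V := by
    intro k hk
    have hp : (1 / 2 : ℝ) ≤ ‖p₀ + latticeVec k‖ := half_le_norm_reprSym_add_latticeVec _ hk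
    have h := measure_setOf_ray_meets_closedBall_le_of_le volume (p₀ + latticeVec k) hr
      (by linarith : 2 * r ≤ 1 / 2) hp hW (hn ▸ hd)
    rw [hn] at h
    exact h
  have hCle : ∀ k : d → ℤ, volume (C k) ≤
      (if k = 0 then ENNReal.ofReal a₀ * V else 0) + ENNReal.ofReal a₁ * V := by
    intro k
    by_cases hk : k = 0
    · rw [if_pos hk, hk]
      exact le_add_right hC0
    · rw [if_neg hk, zero_add]
      exact hCk k hk
  -- the number of cones
  have hcard : (S.card : ℝ) ≤ (2 * (t * W) + 2) ^ n := by
    have hsub : S ⊆ Fintype.piFinset fun i => Finset.Icc ⌈-p₀ i - ρ⌉ ⌊-p₀ i + ρ⌋ := by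
      rw [hS_def, Set.Finite.toFinset_subset]
      exact setOf_norm_add_latticeVec_le_subset p₀ ρ
    calc (S.card : ℝ) ≤ (Fintype.piFinset fun i => Finset.Icc ⌈-p₀ i - ρ⌉ ⌊-p₀ i + ρ⌋).card := by
          exact_mod_cast Finset.card_le_card hsub
      _ ≤ (2 * ρ + 1) ^ n := card_piFinset_Icc_le p₀ hρ0
      _ ≤ (2 * (t * W) + 2) ^ n := by
          apply pow_le_pow_left₀ (by positivity)
          rw [hρ_def]
          linarith
  -- summing up
  calc volume {w : EuclideanSpace ℝ d | ‖w‖ ≤ W ∧ ∃ k : d → ℤ,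
        ‖p₀ + latticeVec k‖ ≤ ρ ∧ ∃ u : ℝ, 0 ≤ u ∧ ‖u • w - (p₀ + latticeVec k)‖ ≤ r}
      ≤ volume (⋃ k ∈ S, C k) := measure_mono hcover
    _ ≤ ∑ k ∈ S, volume (C k) := measure_biUnion_finset_le _ _
    _ ≤ ∑ k ∈ S, ((if k = 0 then ENNReal.ofReal a₀ * V else 0) + ENNReal.ofReal a₁ * V) :=
        Finset.sum_le_sum fun k _ => hCle k
    _ = (∑ k ∈ S, if k = 0 then ENNReal.ofReal a₀ * V else 0) +
          S.card * (ENNReal.ofReal a₁ * V) := by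
        rw [Finset.sum_add_distrib, Finset.sum_const, nsmul_eq_mul]
    _ ≤ ENNReal.ofReal a₀ * V + ENNReal.ofReal ((2 * (t * W) + 2) ^ n) *
          (ENNReal.ofReal a₁ * V) := by
        refine add_le_add ?_ (mul_le_mul_of_nonneg_right ?_ bot_le)
        · rw [Finset.sum_ite_eq']
          split_ifs
          · exact le_rfl
          · exact bot_le
        · rw [← ENNReal.ofReal_natCast]
          exact ENNReal.ofReal_le_ofReal hcard
    _ = ENNReal.ofReal (a₀ + (2 * (t * W) + 2) ^ n * a₁) * V := by
        rw [ENNReal.ofReal_add ha₀0 (by positivity), add_mul,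
          ENNReal.ofReal_mul (by positivity : (0 : ℝ) ≤ (2 * (t * W) + 2) ^ n), mul_assoc]
    _ = ENNReal.ofReal (2 * 6 ^ n * W ^ n *
          ((3 * ā / ε₀) ^ (n - 1) + (2 * (t * W) + 2) ^ n * (6 * ā) ^ (n - 1))) * V := by
        congr 2
        rw [ha₀_def, ha₁_def, hr_def]
        have : 3 * ā / (1 / 2) = 6 * ā := by ring
        rw [this]
        ring

end TorusLemma


/-! ## Thin tubes (for the delay `δ` of Lemma 5.2, second bullet) -/

open scoped RealInnerProductSpace

section Cylinder

variable {E : Type*} [NormedAddCommGroup E] [InnerProductSpace ℝ E] [FiniteDimensional ℝ E]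
  [MeasurableSpace E] [BorelSpace E]

omit [FiniteDimensional ℝ E] [MeasurableSpace E] [BorelSpace E] in
/-- **Pythagoras along a unit vector**: for `‖e‖ = 1`, the component of `w` orthogonal to `e`
is dominated by the distance of `u • w` to any point `c • e` of the axis, scaled by `u`:
`u ‖w - ⟪w, e⟫ e‖ ≤ ‖u • w - c • e‖` (`u ≥ 0`). [folklore] -/
theorem mul_norm_sub_inner_smul_le {e : E} (he : ‖e‖ = 1) (w : E) {u : ℝ} (hu : 0 ≤ u)
    (c : ℝ) : u * ‖w - ⟪w, e⟫ • e‖ ≤ ‖u • w - c • e‖ := by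
  set a : E := u • (w - ⟪w, e⟫ • e) with ha
  set b : E := (u * ⟪w, e⟫ - c) • e with hb
  have hsplit : u • w - c • e = a + b := by
    rw [ha, hb, smul_sub, sub_smul, mul_smul]
    abel
  have hee : ⟪e, e⟫ = 1 := by
    rw [real_inner_self_eq_norm_sq, he, one_pow]
  have horth : ⟪a, b⟫ = 0 := by
    rw [ha, hb, inner_smul_left, inner_smul_right, inner_sub_left, inner_smul_left, hee]
    simp
  have hpy : ‖a + b‖ * ‖a + b‖ = ‖a‖ * ‖a‖ + ‖b‖ * ‖b‖ :=
    norm_add_sq_eq_norm_sq_add_norm_sq_of_inner_eq_zero a b horth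
  have hna : ‖a‖ = u * ‖w - ⟪w, e⟫ • e‖ := by
    rw [ha, norm_smul, Real.norm_of_nonneg hu]
  rw [hsplit, ← hna]
  nlinarith [norm_nonneg (a + b), norm_nonneg a, norm_nonneg b]

omit [FiniteDimensional ℝ E] [MeasurableSpace E] [BorelSpace E] in
/-- **Covering of a thin tube by balls.** For a unit vector `e`, `0 < η`, `0 ≤ W`, `0 ≤ s`:
every `w` with `‖w‖ ≤ W` and `‖w - ⟪w, e⟫ e‖ ≤ s` lies in one of the balls
`closedBall ((j η) • e) (s + η/2)`, `j ∈ ℤ`, `|j| ≤ ⌊W/η + 1/2⌋` (take `j = round (⟪w, e⟫/η)`).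
[folklore] -/
theorem setOf_norm_sub_inner_smul_le_subset {e : E} (he : ‖e‖ = 1) {η W s : ℝ} (hη : 0 < η)
    (hW : 0 ≤ W) :
    {w : E | ‖w‖ ≤ W ∧ ‖w - ⟪w, e⟫ • e‖ ≤ s} ⊆
      ⋃ j ∈ Finset.Icc (-(⌊W / η + 1 / 2⌋₊ : ℤ)) ⌊W / η + 1 / 2⌋₊,
        closedBall (((j : ℝ) * η) • e) (s + η / 2) := by
  intro w hw
  obtain ⟨hwW, hws⟩ := hw
  set a : ℝ := ⟪w, e⟫ with ha
  have haW : |a| ≤ W := by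
    have h := abs_real_inner_le_norm w e
    rw [he, mul_one] at h
    exact h.trans hwW
  set j : ℤ := round (a / η) with hj
  have hround : |a / η - j| ≤ 1 / 2 := abs_sub_round (a / η)
  have hjabs : |(j : ℝ)| ≤ W / η + 1 / 2 := by
    have h1 : |(j : ℝ)| ≤ |a / η| + 1 / 2 := by
      have := abs_sub_abs_le_abs_sub (j : ℝ) (a / η)
      rw [abs_sub_comm] at this
      linarith
    have h2 : |a / η| ≤ W / η := by
      rw [abs_div, abs_of_pos hη]
      exact div_le_div_of_nonneg_right haW hη.le
    linarith
  have hjmem : j ∈ Finset.Icc (-(⌊W / η + 1 / 2⌋₊ : ℤ)) ⌊W / η + 1 / 2⌋₊ := by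
    have hM : |j| ≤ (⌊W / η + 1 / 2⌋₊ : ℤ) := by
      have h0 : 0 ≤ W / η + 1 / 2 := by positivity
      have h1 : ((|j| : ℤ) : ℝ) ≤ W / η + 1 / 2 := by
        rw [Int.cast_abs]
        exact hjabs
      have h2 : |j| ≤ ⌊W / η + 1 / 2⌋ := Int.le_floor.2 h1
      rwa [← Int.natCast_floor_eq_floor h0] at h2
    rw [Finset.mem_Icc]
    exact abs_le.1 hM
  refine mem_iUnion₂.2 ⟨j, hjmem, ?_⟩
  rw [mem_closedBall, dist_eq_norm]
  have hsplit : w - ((j : ℝ) * η) • e = (w - a • e) + (a - j * η) • e := by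
    rw [sub_smul]
    abel
  rw [hsplit]
  calc ‖w - a • e + (a - ↑j * η) • e‖ ≤ ‖w - a • e‖ + ‖(a - ↑j * η) • e‖ := norm_add_le _ _
    _ = ‖w - a • e‖ + |a - j * η| := by rw [norm_smul, he, mul_one, Real.norm_eq_abs]
    _ ≤ s + η / 2 := by
        refine add_le_add hws ?_
        have : a - j * η = (a / η - j) * η := by
          field_simp
        rw [this, abs_mul, abs_of_pos hη]
        nlinarith [hround]

/-- **The tube estimate** (BGSR App. B, second bullet: "`v₁ - v₂` belongs to the intersection
of `B_{2E}(0)` and some cylinder of radius `ε₀/δ`", of size `C E (ε₀/δ)^{d-1}`). For an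
additive Haar measure on a finite-dimensional real inner product space, a unit vector `e` and
`0 < s ≤ W`: the set of `w` with `‖w‖ ≤ W` at distance `≤ s` from the axis `ℝ e` has measure at
most `3 · 2^{dim} W s^{dim-1} μ(ball 0 1)` (cover by `≤ W/s + 2` balls of radius `2s` centred on
the axis, and `(W/s + 2)(2s)^{dim} ≤ 6 W (2s)^{dim - 1}`).
[cite: BodineauGallagherSaintRaymondInvent2016, Appendix B] -/
theorem measure_setOf_norm_sub_inner_smul_le (μ : Measure E) [μ.IsAddHaarMeasure] {e : E}
    (he : ‖e‖ = 1) {W s : ℝ} (hs : 0 < s) (hsW : s ≤ W) (hm : 1 ≤ Module.finrank ℝ E) :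
    μ {w : E | ‖w‖ ≤ W ∧ ‖w - ⟪w, e⟫ • e‖ ≤ s} ≤
      ENNReal.ofReal (3 * 2 ^ Module.finrank ℝ E * W * s ^ (Module.finrank ℝ E - 1)) *
        μ (ball (0 : E) 1) := by
  have hW : 0 < W := hs.trans_le hsW
  set η : ℝ := 2 * s with hη_def
  have hη : 0 < η := by positivity
  set M : ℕ := ⌊W / η + 1 / 2⌋₊ with hM_def
  have hρ0 : 0 ≤ s + η / 2 := by positivity
  have hρ : s + η / 2 = 2 * s := by
    rw [hη_def]
    ring
  obtain ⟨j, hj⟩ : ∃ j : ℕ, Module.finrank ℝ E = j + 1 := ⟨_, (Nat.succ_pred_eq_of_pos hm).symm⟩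
  have hcard : ((Finset.Icc (-(M : ℤ)) M).card : ℝ) ≤ W / s + 2 := by
    rw [Int.card_Icc, ← Int.cast_natCast, Int.toNat_of_nonneg (by omega)]
    push_cast
    have hM : (M : ℝ) ≤ W / η + 1 / 2 := Nat.floor_le (by positivity)
    rw [hη_def] at hM
    have h1 : (M : ℝ) + 1 - -(M : ℝ) = 2 * M + 1 := by ring
    have h2 : W / (2 * s) = W / s / 2 := by rw [div_div, mul_comm]
    rw [h1]
    rw [h2] at hM
    linarith
  calc μ {w : E | ‖w‖ ≤ W ∧ ‖w - ⟪w, e⟫ • e‖ ≤ s}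
      ≤ μ (⋃ j ∈ Finset.Icc (-(M : ℤ)) M, closedBall (((j : ℝ) * η) • e) (s + η / 2)) :=
        measure_mono (setOf_norm_sub_inner_smul_le_subset he hη hW.le)
    _ ≤ ∑ j ∈ Finset.Icc (-(M : ℤ)) M, μ (closedBall (((j : ℝ) * η) • e) (s + η / 2)) :=
        measure_biUnion_finset_le _ _
    _ = ∑ _j ∈ Finset.Icc (-(M : ℤ)) M,
          ENNReal.ofReal ((s + η / 2) ^ Module.finrank ℝ E) * μ (ball (0 : E) 1) :=
        Finset.sum_congr rfl fun i _ => Measure.addHaar_closedBall μ _ hρ0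
    _ = ((Finset.Icc (-(M : ℤ)) M).card : ENNReal) *
          (ENNReal.ofReal ((2 * s) ^ Module.finrank ℝ E) * μ (ball (0 : E) 1)) := by
        rw [Finset.sum_const, nsmul_eq_mul, hρ]
    _ = ENNReal.ofReal (((Finset.Icc (-(M : ℤ)) M).card : ℝ) * (2 * s) ^ Module.finrank ℝ E) *
          μ (ball (0 : E) 1) := by
        rw [← mul_assoc, ENNReal.ofReal_mul (Nat.cast_nonneg _), ENNReal.ofReal_natCast]
    _ ≤ ENNReal.ofReal (3 * 2 ^ Module.finrank ℝ E * W * s ^ (Module.finrank ℝ E - 1)) *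
          μ (ball (0 : E) 1) := by
        refine mul_le_mul_of_nonneg_right (ENNReal.ofReal_le_ofReal ?_) bot_le
        calc ((Finset.Icc (-(M : ℤ)) M).card : ℝ) * (2 * s) ^ Module.finrank ℝ E
            ≤ (W / s + 2) * (2 * s) ^ Module.finrank ℝ E :=
              mul_le_mul_of_nonneg_right hcard (by positivity)
          _ = (2 * W + 4 * s) * (2 * s) ^ j := by
              rw [hj, pow_succ]
              field_simp
              ring
          _ ≤ (6 * W) * (2 * s) ^ j := by
              apply mul_le_mul_of_nonneg_right _ (by positivity)
              linarith
          _ = 3 * 2 ^ Module.finrank ℝ E * W * s ^ (Module.finrank ℝ E - 1) := by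
              rw [hj, Nat.add_sub_cancel, pow_succ, mul_pow]
              ring

end Cylinder

/-! ## BGSR Lemma 5.2 (second half) on the flat torus -/

section TorusLemmaDelta

open Literature.Analysis.FunctionSpaces Literature.Analysis.FunctionSpaces.Torus
open Literature.Analysis.FluidPDE Literature.Analysis.FluidPDE.Torus

variable {d : Type*} [Fintype d] [DecidableEq d]

/-- **The lifting step** (BGSR App. B: "boils down to having `u(v₁ - v₂) ∈ B(x₁⁰ - x₂⁰ + k)` for
some `k ∈ ℤ^d`"): if `euclidDist xᵢ yᵢ ≤ ā` and the free flights `x₁ - proj (u v₁)`,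
`x₂ - proj (u v₂)` (`u ≥ 0`) are at minimal-image distance `≤ ε`, then for some lattice
translate `p₀ + k` of `p₀ = reprSym (y₁ - y₂)`, `‖u (v₁ - v₂) - (p₀ + k)‖ ≤ ε + 2ā` and
`‖p₀ + k‖ ≤ u ‖v₁ - v₂‖ + ε + 2ā`. [cite: BodineauGallagherSaintRaymondInvent2016, Appendix B] -/
theorem exists_latticeVec_of_euclidDist_freeFlight_le {ā ε u : ℝ} {y₁ y₂ x₁ x₂ : UnitAddTorus d}
    {v₁ v₂ : EuclideanSpace ℝ d} (hx₁ : euclidDist x₁ y₁ ≤ ā) (hx₂ : euclidDist x₂ y₂ ≤ ā)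
    (hu0 : 0 ≤ u) (hle : euclidDist (x₁ - proj (u • v₁)) (x₂ - proj (u • v₂)) ≤ ε) :
    ∃ k : d → ℤ, ‖u • (v₁ - v₂) - (reprSym (y₁ - y₂) + latticeVec k)‖ ≤ ε + 2 * ā ∧
      ‖reprSym (y₁ - y₂) + latticeVec k‖ ≤ u * ‖v₁ - v₂‖ + ε + 2 * ā := by
  set p₀ := reprSym (y₁ - y₂) with hp₀
  set e₁ := reprSym (x₁ - y₁) with he₁
  set e₂ := reprSym (x₂ - y₂) with he₂
  set w := v₁ - v₂ with hw
  set q := p₀ + e₁ - e₂ - u • w with hq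
  have hdiff : (x₁ - proj (u • v₁)) - (x₂ - proj (u • v₂)) = proj q := by
    have h1 : proj p₀ = y₁ - y₂ := proj_reprSym _
    have h2 : proj e₁ = x₁ - y₁ := proj_reprSym _
    have h3 : proj e₂ = x₂ - y₂ := proj_reprSym _
    have hps : ∀ a b : EuclideanSpace ℝ d, proj (a - b) = proj a - proj b := fun _ _ => rfl
    rw [hq, hps, hps, proj_add, h1, h2, h3, hw, smul_sub, hps]
    abel
  obtain ⟨k, hk⟩ := exists_reprSym_eq_add_latticeVec q
  have hqk : ‖q + latticeVec k‖ ≤ ε := by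
    rw [← hk, ← hdiff]
    exact hle
  have he₁n : ‖e₁‖ ≤ ā := hx₁
  have he₂n : ‖e₂‖ ≤ ā := hx₂
  have hclose : ‖u • w - (p₀ + latticeVec k)‖ ≤ ε + 2 * ā := by
    have hsplit : u • w - (p₀ + latticeVec k) = -(q + latticeVec k) + e₁ - e₂ := by
      rw [hq]
      abel
    rw [hsplit]
    calc ‖-(q + latticeVec k) + e₁ - e₂‖ ≤ ‖-(q + latticeVec k) + e₁‖ + ‖e₂‖ := norm_sub_le _ _
      _ ≤ ‖-(q + latticeVec k)‖ + ‖e₁‖ + ‖e₂‖ := by gcongr; exact norm_add_le _ _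
      _ ≤ ε + ā + ā := by rw [norm_neg]; gcongr
      _ = ε + 2 * ā := by ring
  refine ⟨k, hclose, ?_⟩
  have h1 : ‖p₀ + latticeVec k‖ ≤ ‖u • w‖ + ‖u • w - (p₀ + latticeVec k)‖ := by
    have := norm_sub_le (u • w) (u • w - (p₀ + latticeVec k))
    rwa [sub_sub_cancel] at this
  have h2 : ‖u • w‖ = u * ‖w‖ := by
    rw [norm_smul, Real.norm_of_nonneg hu0]
  linarith

/-- **BGSR Lemma 5.2, second half — avoidance after the delay `δ`** (arXiv:1305.3397v2
Lemma 5.2, second bullet, and Appendix B, second bullet; the paper's `x₁⁰, x₂⁰` are `y₁, y₂`).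
With `p₀ = reprSym (y₁ - y₂)` and the bad set of relative velocities
`K_δ = {w : ‖w‖ ≤ W, (∃ u ≥ δ, ‖uw - p₀‖ ≤ 3ε₀) ∨ (∃ k ≠ 0, ‖p₀ + k‖ ≤ tW + 3ε₀, ∃ u ≥ 0,
‖uw - (p₀ + k)‖ ≤ 3ε₀)}`: if `euclidDist xᵢ yᵢ ≤ ā ≤ ε₀`, `‖v₁ - v₂‖ ≤ W`, `v₁ - v₂ ∉ K_δ`,
`0 ≤ u`, `δ ≤ u ≤ t`, then `euclidDist (x₁ - proj (u v₁)) (x₂ - proj (u v₂)) > ε₀` ("If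
`v₁ - v₂ ∉ K_δ(x₁⁰ - x₂⁰, ε₀, ā)`, `∀ u ∈ [δ, t], d(x₁ - u v₁, x₂ - u v₂) > ε₀`").
[cite: BodineauGallagherSaintRaymondInvent2016, Lemma 5.2 and Appendix B] -/
theorem bgsr_lemma52_delta_avoid {t ā ε₀ W δ u : ℝ} (hāε₀ : ā ≤ ε₀)
    {y₁ y₂ x₁ x₂ : UnitAddTorus d} {v₁ v₂ : EuclideanSpace ℝ d} (hx₁ : euclidDist x₁ y₁ ≤ ā)
    (hx₂ : euclidDist x₂ y₂ ≤ ā) (hvW : ‖v₁ - v₂‖ ≤ W) (hu0 : 0 ≤ u) (hδu : δ ≤ u) (hut : u ≤ t)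
    (hK : v₁ - v₂ ∉ {w : EuclideanSpace ℝ d | ‖w‖ ≤ W ∧
        ((∃ u : ℝ, δ ≤ u ∧ ‖u • w - reprSym (y₁ - y₂)‖ ≤ 3 * ε₀) ∨
          ∃ k : d → ℤ, k ≠ 0 ∧ ‖reprSym (y₁ - y₂) + latticeVec k‖ ≤ t * W + 3 * ε₀ ∧
            ∃ u : ℝ, 0 ≤ u ∧ ‖u • w - (reprSym (y₁ - y₂) + latticeVec k)‖ ≤ 3 * ε₀)}) :
    ε₀ < euclidDist (x₁ - proj (u • v₁)) (x₂ - proj (u • v₂)) := by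
  by_contra hle
  push Not at hle
  obtain ⟨k, hclose, hfar⟩ := exists_latticeVec_of_euclidDist_freeFlight_le hx₁ hx₂ hu0 hle
  have hclose' : ‖u • (v₁ - v₂) - (reprSym (y₁ - y₂) + latticeVec k)‖ ≤ 3 * ε₀ := by
    linarith
  have hW0 : 0 ≤ W := (norm_nonneg _).trans hvW
  have hfar' : ‖reprSym (y₁ - y₂) + latticeVec k‖ ≤ t * W + 3 * ε₀ := by
    have : u * ‖v₁ - v₂‖ ≤ t * W := mul_le_mul hut hvW (norm_nonneg _) (hu0.trans hut)
    linarith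
  refine hK ⟨hvW, ?_⟩
  by_cases hk : k = 0
  · left
    refine ⟨u, hδu, ?_⟩
    rw [hk, latticeVec_zero, add_zero] at hclose'
    exact hclose'
  · right
    exact ⟨k, hk, hfar', u, hu0, hclose'⟩

/-- **BGSR Lemma 5.2, second half — the size of the bad set `K_δ`** (arXiv:1305.3397v2
Lemma 5.2 and Appendix B, second bullet: `|K_δ| ≤ C E ((ε₀/δ)^{d-1} + (Et)^d E^{d-1} ε₀^{d-1})`,
a "cylinder of radius `ε₀/δ`" for the nearest image and cones "of solid angle `ε₀^{d-1}`" for the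
other translates). Here, with `W` for `2E`, `y₁, y₂` for the paper's `x₁⁰, x₂⁰` and explicit
constants: if `0 < ε₀ ≤ 1/12`, `0 < δ`, `3ε₀/δ ≤ W`, `0 ≤ t`, `d ≥ 1` and
`ε₀ ≤ euclidDist y₁ y₂`, the bad set of `bgsr_lemma52_delta_avoid` has volume at most
`(3·2^d W (3ε₀/δ)^{d-1} + (2tW + 2)^d · 2·6^d W^d (6ε₀)^{d-1}) |B₁|` (the nearest image gives
the tube `measure_setOf_norm_sub_inner_smul_le` around `p₀/‖p₀‖` via
`mul_norm_sub_inner_smul_le`; every other translate has length `≥ 1/2`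
(`half_le_norm_reprSym_add_latticeVec`) and gives a cone
`measure_setOf_ray_meets_closedBall_le_of_le`; there are at most `(2tW+2)^d` of them within
reach, `card_piFinset_Icc_le`).
[cite: BodineauGallagherSaintRaymondInvent2016, Lemma 5.2 and Appendix B] -/
theorem bgsr_lemma52_delta_volume {t ε₀ W δ : ℝ} (hε₀ : 0 < ε₀) (hε₀12 : ε₀ ≤ 1 / 12)
    (hδ : 0 < δ) (hδW : 3 * ε₀ / δ ≤ W) (ht : 0 ≤ t) (hd : 1 ≤ Fintype.card d)
    {y₁ y₂ : UnitAddTorus d} (hsep : ε₀ ≤ euclidDist y₁ y₂) :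
    volume {w : EuclideanSpace ℝ d | ‖w‖ ≤ W ∧
        ((∃ u : ℝ, δ ≤ u ∧ ‖u • w - reprSym (y₁ - y₂)‖ ≤ 3 * ε₀) ∨
          ∃ k : d → ℤ, k ≠ 0 ∧ ‖reprSym (y₁ - y₂) + latticeVec k‖ ≤ t * W + 3 * ε₀ ∧
            ∃ u : ℝ, 0 ≤ u ∧ ‖u • w - (reprSym (y₁ - y₂) + latticeVec k)‖ ≤ 3 * ε₀)} ≤
      ENNReal.ofReal (3 * 2 ^ Fintype.card d * W * (3 * ε₀ / δ) ^ (Fintype.card d - 1) +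
          (2 * (t * W) + 2) ^ Fintype.card d *
            (2 * 6 ^ Fintype.card d * W ^ Fintype.card d *
              (6 * ε₀) ^ (Fintype.card d - 1))) *
        volume (ball (0 : EuclideanSpace ℝ d) 1) := by
  classical
  set n := Fintype.card d with hn_def
  have hn : Module.finrank ℝ (EuclideanSpace ℝ d) = n := finrank_euclideanSpace
  set p₀ := reprSym (y₁ - y₂) with hp₀_def
  have hp₀n : ε₀ ≤ ‖p₀‖ := hsep
  have hp₀0 : 0 < ‖p₀‖ := hε₀.trans_le hp₀n
  have hp₀ne : p₀ ≠ 0 := norm_pos_iff.1 hp₀0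
  set s : ℝ := 3 * ε₀ / δ with hs_def
  have hs0 : 0 < s := by positivity
  have hW : 0 < W := hs0.trans_le hδW
  set ρ : ℝ := t * W + 3 * ε₀ with hρ_def
  have hρ0 : 0 ≤ ρ := by positivity
  set r : ℝ := 3 * ε₀ with hr_def
  have hr : 0 < r := by positivity
  set V := volume (ball (0 : EuclideanSpace ℝ d) 1) with hV_def
  set acyl : ℝ := 3 * 2 ^ n * W * s ^ (n - 1) with hacyl_def
  set a₁ : ℝ := 2 * 6 ^ n * W ^ n * (r / (1 / 2)) ^ (n - 1) with ha₁_def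
  have hacyl0 : 0 ≤ acyl := by positivity
  have ha₁0 : 0 ≤ a₁ := by positivity
  -- the unit vector of the nearest image and its tube
  set e : EuclideanSpace ℝ d := ‖p₀‖⁻¹ • p₀ with he_def
  have he : ‖e‖ = 1 := by
    rw [he_def, norm_smul, norm_inv, norm_norm, inv_mul_cancel₀ hp₀0.ne']
  have hpe : p₀ = ‖p₀‖ • e := by
    rw [he_def, smul_smul, mul_inv_cancel₀ hp₀0.ne', one_smul]
  set Cyl : Set (EuclideanSpace ℝ d) := {w | ‖w‖ ≤ W ∧ ‖w - ⟪w, e⟫ • e‖ ≤ s} with hCyl_def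
  -- the cones of the other translates
  set D : (d → ℤ) → Set (EuclideanSpace ℝ d) := fun k =>
    {w | ‖w‖ ≤ W ∧ ∃ u : ℝ, 0 ≤ u ∧ ‖u • w - (p₀ + latticeVec k)‖ ≤ r} with hD_def
  set D' : (d → ℤ) → Set (EuclideanSpace ℝ d) := fun k => {w | k ≠ 0 ∧ w ∈ D k} with hD'_def
  have hfin := finite_setOf_norm_add_latticeVec_le p₀ ρ
  set S : Finset (d → ℤ) := hfin.toFinset with hS_def
  have hcover : {w : EuclideanSpace ℝ d | ‖w‖ ≤ W ∧
      ((∃ u : ℝ, δ ≤ u ∧ ‖u • w - p₀‖ ≤ r) ∨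
        ∃ k : d → ℤ, k ≠ 0 ∧ ‖p₀ + latticeVec k‖ ≤ ρ ∧
          ∃ u : ℝ, 0 ≤ u ∧ ‖u • w - (p₀ + latticeVec k)‖ ≤ r)} ⊆ Cyl ∪ ⋃ k ∈ S, D' k := by
    rintro w ⟨hwW, h | h⟩
    · left
      obtain ⟨u, hδu, hur⟩ := h
      have hu0 : 0 < u := hδ.trans_le hδu
      refine ⟨hwW, ?_⟩
      have h1 : u * ‖w - ⟪w, e⟫ • e‖ ≤ r := by
        have h := mul_norm_sub_inner_smul_le he w hu0.le ‖p₀‖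
        rw [← hpe] at h
        exact h.trans hur
      rw [hs_def, le_div_iff₀ hδ]
      calc ‖w - ⟪w, e⟫ • e‖ * δ ≤ ‖w - ⟪w, e⟫ • e‖ * u :=
            mul_le_mul_of_nonneg_left hδu (norm_nonneg _)
        _ = u * ‖w - ⟪w, e⟫ • e‖ := mul_comm _ _
        _ ≤ r := h1
        _ = 3 * ε₀ := hr_def
    · right
      obtain ⟨k, hk, hkρ, u, hu, hur⟩ := h
      refine mem_iUnion₂.2 ⟨k, ?_, hk, hwW, u, hu, hur⟩
      rw [hS_def, Set.Finite.mem_toFinset]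
      exact hkρ
  -- the tube is small
  have hCyl : volume Cyl ≤ ENNReal.ofReal acyl * V := by
    have h := measure_setOf_norm_sub_inner_smul_le volume he hs0 hδW (hn ▸ hd)
    rw [hn] at h
    exact h
  -- each cone is small (and `D' 0 = ∅`)
  have hD' : ∀ k : d → ℤ, volume (D' k) ≤ ENNReal.ofReal a₁ * V := by
    intro k
    by_cases hk : k = 0
    · have hempty : D' k = ∅ := by
        ext w
        simp [hD'_def, hk]
      rw [hempty, measure_empty]
      exact bot_le
    · have hsub : D' k ⊆ D k := fun w hw => hw.2
      have hp : (1 / 2 : ℝ) ≤ ‖p₀ + latticeVec k‖ := half_le_norm_reprSym_add_latticeVec _ hk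
      have h := measure_setOf_ray_meets_closedBall_le_of_le volume (p₀ + latticeVec k) hr
        (by linarith : 2 * r ≤ 1 / 2) hp hW (hn ▸ hd)
      rw [hn] at h
      exact (measure_mono hsub).trans h
  -- the number of cones
  have hcard : (S.card : ℝ) ≤ (2 * (t * W) + 2) ^ n := by
    have hsub : S ⊆ Fintype.piFinset fun i => Finset.Icc ⌈-p₀ i - ρ⌉ ⌊-p₀ i + ρ⌋ := by
      rw [hS_def, Set.Finite.toFinset_subset]
      exact setOf_norm_add_latticeVec_le_subset p₀ ρ
    calc (S.card : ℝ) ≤ (Fintype.piFinset fun i => Finset.Icc ⌈-p₀ i - ρ⌉ ⌊-p₀ i + ρ⌋).card := by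
          exact_mod_cast Finset.card_le_card hsub
      _ ≤ (2 * ρ + 1) ^ n := card_piFinset_Icc_le p₀ hρ0
      _ ≤ (2 * (t * W) + 2) ^ n := by
          apply pow_le_pow_left₀ (by positivity)
          rw [hρ_def]
          linarith
  -- summing up
  calc volume {w : EuclideanSpace ℝ d | ‖w‖ ≤ W ∧
        ((∃ u : ℝ, δ ≤ u ∧ ‖u • w - p₀‖ ≤ r) ∨
          ∃ k : d → ℤ, k ≠ 0 ∧ ‖p₀ + latticeVec k‖ ≤ ρ ∧
            ∃ u : ℝ, 0 ≤ u ∧ ‖u • w - (p₀ + latticeVec k)‖ ≤ r)}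
      ≤ volume (Cyl ∪ ⋃ k ∈ S, D' k) := measure_mono hcover
    _ ≤ volume Cyl + volume (⋃ k ∈ S, D' k) := measure_union_le _ _
    _ ≤ ENNReal.ofReal acyl * V + ∑ k ∈ S, volume (D' k) :=
        add_le_add hCyl (measure_biUnion_finset_le _ _)
    _ ≤ ENNReal.ofReal acyl * V + ∑ _k ∈ S, ENNReal.ofReal a₁ * V :=
        add_le_add le_rfl (Finset.sum_le_sum fun k _ => hD' k)
    _ = ENNReal.ofReal acyl * V + S.card * (ENNReal.ofReal a₁ * V) := by
        rw [Finset.sum_const, nsmul_eq_mul]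
    _ ≤ ENNReal.ofReal acyl * V + ENNReal.ofReal ((2 * (t * W) + 2) ^ n) *
          (ENNReal.ofReal a₁ * V) := by
        refine add_le_add le_rfl (mul_le_mul_of_nonneg_right ?_ bot_le)
        rw [← ENNReal.ofReal_natCast]
        exact ENNReal.ofReal_le_ofReal hcard
    _ = ENNReal.ofReal (acyl + (2 * (t * W) + 2) ^ n * a₁) * V := by
        rw [ENNReal.ofReal_add hacyl0 (by positivity), add_mul,
          ENNReal.ofReal_mul (by positivity : (0 : ℝ) ≤ (2 * (t * W) + 2) ^ n), mul_assoc]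
    _ = ENNReal.ofReal (3 * 2 ^ n * W * (3 * ε₀ / δ) ^ (n - 1) +
          (2 * (t * W) + 2) ^ n * (2 * 6 ^ n * W ^ n * (6 * ε₀) ^ (n - 1))) * V := by
        congr 2
        rw [hacyl_def, ha₁_def, hr_def, hs_def]
        have : 3 * ε₀ / (1 / 2) = 6 * ε₀ := by ring
        rw [this]

end TorusLemmaDelta
end

end Literature.MathematicalPhysics.KineticTheory
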